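import Mathlib
import Summits.MatrixMultiplication.MatrixMultiplication.Theorems.GradedDesignFamily.Negative.SL2Generators

/-!
# Towards (Dickson): root lines and root groups in `SL₂(K) = ker det ⊆ GL₂(K)`
# (crux `LevelGradedCohnUmans.GradedDesignFamily`, stmt-MatrixMultiplication-7610; negative side,
# line `quadratic-extension-level-one-cell`, unit b2b-lgcu-subfield gen 18)

HONEST FRAMING.  After gen 18, `¬ stub_subfieldCell ⇐ (BGT) ∧ (Dickson)`
(`not_subfieldCell_of_BGT_Dickson`).  This file lands the two ELEMENTARY pieces (D1), (D2) of the
plan for (Dickson) recorded in the cell doc (SUBFIELD.md §23.6):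

* `fixesLine_of_conj_fixed` (D1) — if some `u` fixes the non-zero vector `v`, and every
  `L`-conjugate of `u` fixes only the line `K v`, then the whole subgroup `L` preserves `K v`
  (the case "exactly one root line");
* `ker_det_le_of_rootGroups` (D2) — if `L ≤ GL₂(K)` contains the `g₀`-conjugates of ALL upper
  and ALL lower unitriangular matrices (two full root groups), then `ker det ≤ L`
  (`sl2md_decomp`: every element of `SL₂(K)` is a word `u_a l_c u_b l_d`).

Support lemmas only; the heart of (Dickson) (two root lines with a non-full root group) is NOT
addressed.  NOT summit progress.

Sorry-free. [folklore]
-/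

set_option linter.dupNamespace false

open Matrix

namespace Summit.MatrixMultiplication.MatrixMultiplication.Theorems.GradedDesignFamily.Negative

/-- **(D1) one root line.**  Let `L ≤ GL₂(K)`, `u ∈ GL₂(K)` (typically a non-trivial unipotent
of `L`), `v ≠ 0` with `u v = v`, and suppose every conjugate `g u g⁻¹` (`g ∈ L`) fixes only vectors
on the line `K v`.  Then `L` preserves `K v`. [folklore] -/
theorem fixesLine_of_conj_fixed {K : Type} [Field K]
    (L : Subgroup (Matrix.GeneralLinearGroup (Fin 2) K)) (u : Matrix.GeneralLinearGroup (Fin 2) K)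
    (v : Fin 2 → K)
    (huv : (u : Matrix (Fin 2) (Fin 2) K) *ᵥ v = v)
    (huniq : ∀ g ∈ L, ∀ w : Fin 2 → K, w ≠ 0 →
      ((g * u * g⁻¹ : Matrix.GeneralLinearGroup (Fin 2) K) : Matrix (Fin 2) (Fin 2) K) *ᵥ w = w →
        ∃ t : K, w = t • v)
    (hv : v ≠ 0) :
    ∀ g ∈ L, ∃ t : K, (g : Matrix (Fin 2) (Fin 2) K) *ᵥ v = t • v := by
  intro g hg
  have hw : (g : Matrix (Fin 2) (Fin 2) K) *ᵥ v ≠ 0 := by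
    intro h0
    apply hv
    have h1 : ((g⁻¹ * g : Matrix.GeneralLinearGroup (Fin 2) K) : Matrix (Fin 2) (Fin 2) K) *ᵥ v = 0 := by
      rw [Units.val_mul, ← Matrix.mulVec_mulVec, h0, Matrix.mulVec_zero]
    rwa [inv_mul_cancel, Units.val_one, Matrix.one_mulVec] at h1
  have hfix : ((g * u * g⁻¹ : Matrix.GeneralLinearGroup (Fin 2) K) : Matrix (Fin 2) (Fin 2) K) *ᵥ
      ((g : Matrix (Fin 2) (Fin 2) K) *ᵥ v) = (g : Matrix (Fin 2) (Fin 2) K) *ᵥ v := by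
    rw [Units.val_mul, Units.val_mul, Matrix.mulVec_mulVec]
    rw [show ((g : Matrix (Fin 2) (Fin 2) K) * (u : Matrix (Fin 2) (Fin 2) K) *
        ((g⁻¹ : Matrix.GeneralLinearGroup (Fin 2) K) : Matrix (Fin 2) (Fin 2) K) *
        (g : Matrix (Fin 2) (Fin 2) K)) = (g : Matrix (Fin 2) (Fin 2) K) * (u : Matrix (Fin 2) (Fin 2) K) by
      rw [mul_assoc, Units.inv_mul, mul_one]]
    rw [← Matrix.mulVec_mulVec, huv]
  exact huniq g hg _ hw hfix

/-- **(D2) two full root groups generate `SL₂(K)`.**  If a subgroup `L ≤ GL₂(K)` contains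
`g₀ u_x g₀⁻¹` and `g₀ l_x g₀⁻¹` for all `x : K` (`u_x = [1,x;0,1]`, `l_x = [1,0;x,1]`), then
`ker det ≤ L`. [folklore] -/
theorem ker_det_le_of_rootGroups {K : Type} [Field K]
    (L : Subgroup (Matrix.GeneralLinearGroup (Fin 2) K)) (g₀ : Matrix.GeneralLinearGroup (Fin 2) K)
    (hU : ∀ x : K, g₀ * Matrix.SpecialLinearGroup.toGL
      (⟨!![(1 : K), x; 0, 1], sl2md_det_upper x⟩ : Matrix.SpecialLinearGroup (Fin 2) K) * g₀⁻¹ ∈ L)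
    (hV : ∀ x : K, g₀ * Matrix.SpecialLinearGroup.toGL
      (⟨!![(1 : K), 0; x, 1], sl2md_det_lower x⟩ : Matrix.SpecialLinearGroup (Fin 2) K) * g₀⁻¹ ∈ L) :
    (Matrix.GeneralLinearGroup.det : Matrix.GeneralLinearGroup (Fin 2) K →* Kˣ).ker ≤ L := by
  intro g hg
  rw [MonoidHom.mem_ker] at hg
  have hdetU : Matrix.GeneralLinearGroup.det (g₀⁻¹ * g * g₀) = 1 := by
    rw [map_mul, map_mul, hg, mul_one, map_inv, inv_mul_cancel]
  have hdet : Matrix.det ((g₀⁻¹ * g * g₀ : Matrix.GeneralLinearGroup (Fin 2) K) :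
      Matrix (Fin 2) (Fin 2) K) = 1 := by
    have h := congrArg Units.val hdetU
    rwa [Matrix.GeneralLinearGroup.val_det_apply, Units.val_one] at h
  obtain ⟨a, b, c, d, habcd⟩ := sl2md_decomp (⟨_, hdet⟩ : Matrix.SpecialLinearGroup (Fin 2) K)
  have key : g₀⁻¹ * g * g₀ =
      Matrix.SpecialLinearGroup.toGL (⟨_, hdet⟩ : Matrix.SpecialLinearGroup (Fin 2) K) := by
    refine Matrix.GeneralLinearGroup.ext fun i j => ?_
    rw [Matrix.SpecialLinearGroup.coe_GL_coe_matrix]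
  have hmem : g₀⁻¹ * g * g₀ ∈ Subgroup.comap (MulAut.conj g₀).toMonoidHom L := by
    rw [key, habcd, map_mul, map_mul, map_mul]
    refine Subgroup.mul_mem _ (Subgroup.mul_mem _ (Subgroup.mul_mem _ ?_ ?_) ?_) ?_
    · simpa only [Subgroup.mem_comap, MulEquiv.coe_toMonoidHom, MulAut.conj_apply] using hU a
    · simpa only [Subgroup.mem_comap, MulEquiv.coe_toMonoidHom, MulAut.conj_apply] using hV c
    · simpa only [Subgroup.mem_comap, MulEquiv.coe_toMonoidHom, MulAut.conj_apply] using hU b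
    · simpa only [Subgroup.mem_comap, MulEquiv.coe_toMonoidHom, MulAut.conj_apply] using hV d
  rw [Subgroup.mem_comap, MulEquiv.coe_toMonoidHom, MulAut.conj_apply] at hmem
  have e : g₀ * (g₀⁻¹ * g * g₀) * g₀⁻¹ = g := by group
  rwa [e] at hmem

end Summit.MatrixMultiplication.MatrixMultiplication.Theorems.GradedDesignFamily.Negative
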